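import Literature.AlgebraicGeometry.Frobenioids.GeometricDivisorDataProjectiveLine
import Literature.NumberTheory.DiophantineGeometry.FunctionFieldGenusRatPlacesProofs
import Literature.AnabelianGeometry.AbsoluteAnabelian.AbsTopIII.KummerIntrinsic
import Literature.AnabelianGeometry.AbsoluteAnabelian.AbsTopIII.KummerFaithfulPadicConsequences
import HarnessLib

/-!
# [AbsTopIII] §1: the projective line `ℙ¹_k` as a NAMED carrier of `DivisorCurveModel` /
# `IntrinsicKummerModel`; Prop. 1.6 (ii) (F-0351) PROVED there, Prop. 1.6 (iii) units (F-0375) in instance form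

S. Mochizuki, *Topics in Absolute Anabelian Geometry III* [AbsTopIII] (bib `MochizukiAbsTopIII2015`; kurims
manuscript `paper:url-5493eb38cbb7`), §1, Prop. 1.6 (ii) p. 35 ("for any divisor `D` of degree `d` on `X`
such that `Supp(D) ⊆ X(k)` [...] if, moreover, `d = 0`, then `t_D : G_k → Π_J` coincides [up to conjugation
by `Δ_X`] with the section determined by the identity element `∈ J(k)` if and only if the divisor `D` is
principal") and Prop. 1.6 (iii) p. 35 ("`1 → (k^×)^∧ → H¹(Π_U, M_X) → ⊕_{x ∈ S} Ẑ`").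

Cell abc-iut, block F, seat abc-iut-f-071 gen 5, KEY «INST59G1» (FACT-LIST F-0351
`DivisorCurveModel.Prop_1_6_ii`, F-0375 `IntrinsicKummerModel.Prop_1_6_iii_units`).  Both rows are SCHEMAS on
free interfaces (universal closures refuted: `DivisorCurveModel.not_forall_prop_1_6_ii`,
`IntrinsicKummerModel.not_forall_prop_1_6_iii_units`); the tree had NO named carrier of either interface
(the counter-models live inside `∃`-proofs; the only instance forms were the empty-curve ones).  THIS FILE
builds a GENUINE one from Mathlib and the tree's Frobenioid file of abc-iut-L1 (`ProjLine.ord`):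

* `ProjLineCarrier.model k : IntrinsicKummerModel.{0}` — `X = ℙ¹_k` (one curve, proper, scheme-like,
  genus `0`): `Π_X := G_k = Gal(k̄/k)` with `Δ_X = 1` (`π₁` of `ℙ¹_{k̄}` is trivial — GENUINE), no cusps,
  `K_X = k(X)` (`RatFunc k`), closed points = ALL places of `k(X)/k` (`ProjLine.Point k`: the height-one
  primes of `k[X]` and `∞`), `ord_x` = the genuine order of vanishing (`ProjLine.ord`, so the DEFINED
  `Γ(ℙ¹, 𝒪^×)` IS `k^×`: `mem_regularUnits_iff_isConstantUnit`, from `ProjLine.forall_ord_eq_zero_iff`),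
  rational points = `∞` and the places `(X - a)` (`AlgFunctionField.idealXSubC a`), their sections
  `s_x := id : G_k → Π_X = G_k` (the unique section), decomposition groups `:= Π_X` (genuine at rational
  points; at a closed point of degree `≥ 2` print's `D_x = G_{k(x)}` is NOT recorded — label), Kummer map
  `κ := 1` into `H¹(Π_X, M_X)` with `M_X = Hom(H²(1, Ẑ), Ẑ) = 0` (genuine for the TYPED cyclotome of a
  genus-`0` curve), NF-flags `True` (genuine for `k` a number field), `NFFunctionField := k(X)` by fiat;
* **F-0351 PROVED at `ℙ¹_k`**: `ProjLineCarrier.prop_1_6_ii k : DivisorCurveModel.Prop_1_6_ii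
  (model k).toDivisorCurveModel` (instance form, 0 hypotheses, head = the decl) — BOTH sides of the printed
  equivalence hold for every degree-`0` divisor supported on rational points: `t_D` is the identity section
  (all sections of `G_k = G_k` coincide: `sectionDiff_eq_one_of_injective`, i.e. `J(ℙ¹) = 0` on the group
  side) AND `D` is principal — `isPrincipal_of_sum_eq_zero`: `D = div(∏_a (X - a)^{D(a)})` at EVERY closed
  point of `ℙ¹_k` (Mathlib's adic valuations: `intValuation_singleton`, `intValuation_eq_one_iff`, and
  `ord_∞ = -deg`), i.e. `Pic⁰` of `ℙ¹` vanishes on rational divisors — the genus-`0` content of print;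
  `binders_prop_1_6_ii_rat`: at `k = ℚ` every binder fires (`IsKummerFaithful ℚ`, a NON-ZERO degree-`0`
  rational divisor `[0] - [∞]`, a section);
* **F-0375 at `ℙ¹_k`**: `ProjLineCarrier.prop_1_6_iii_units k : (model k).Prop_1_6_iii_units` — instance
  form, DEGENERATE in the genus binder ONLY (`2 ≤ genus` fails at genus `0`, exactly print's hyperbolicity
  proviso); the displayed equivalence itself HOLDS at `ℙ¹_k` with content on the right
  (`prop_1_6_iii_units_display`: a regular unit on `ℙ¹` IS a constant; the cusp side is empty).

HONEST LABEL: genuine `π₁`/function-field/divisor data of `ℙ¹_k` as far as the interface records them;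
by-fiat entries listed above; `ℙ¹` is not hyperbolic, so this is a carrier for the TYPED rows, not an
instance of print's setting (hyperbolic orbicurves).  WHY NO HYPERBOLIC NAMED INSTANCE: it needs the étale
`π₁` of a hyperbolic curve with its Galois action and geometric Kummer map (not in the tree).  Refereed
results typed statements-first (D-0014); typed ≠ proved; an instance form about OUR typed statement ≠ the
printed theorem; nothing here bears on [IUTchIII] Cor. 3.12 or asserts that abc is proved or refuted; no
side taken.  No `instance`, no notation, no new named fact.  Axioms standard.
-/

noncomputable section

open CategoryTheory IsDedekindDomain Polynomial
open scoped Classical IsMulCommutative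

namespace Literature.AnabelianGeometry.AbsoluteAnabelian.AbsTopIII

namespace ProjLineCarrier

open Literature.AlgebraicGeometry.Frobenioids
open Literature.NumberTheory.DiophantineGeometry.AlgFunctionField (idealXSubC idealXSubC_asIdeal)

variable (k : Type) [Field k]

/-! ### Orders of rational functions at the closed points of `ℙ¹_k` -/

/-- `ord_x : k(X)^× → ℤ` at a closed point `x` of `ℙ¹_k` (abc-iut-L1's `ProjLine.ord`: Mathlib's `x`-adic
valuation at a finite place, `deg(denom) - deg(num)` at `∞`), as a homomorphism.
[cite: MochizukiAbsTopIII2015, Prop 1.6 (ii) p.35] -/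
def ordHom (P : ProjLine.Point k) : (RatFunc k)ˣ →* Multiplicative ℤ where
  toFun f := Multiplicative.ofAdd (ProjLine.ord f P)
  map_one' := by rw [ProjLine.ord_one]; rfl
  map_mul' f g := by rw [ProjLine.ord_mul]; rfl

/-- `ordHom` is `ord`, additively. [cite: MochizukiAbsTopIII2015, Prop 1.6 (ii) p.35] -/
@[simp] theorem toAdd_ordHom (P : ProjLine.Point k) (f : (RatFunc k)ˣ) :
    Multiplicative.toAdd (ordHom k P f) = ProjLine.ord f P := rfl

/-- The `k`-rational points of `ℙ¹_k`: `∞` and the places `(X - a)`, `a ∈ k`.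
[cite: MochizukiAbsTopIII2015, Prop 1.6 (ii) p.35] -/
def IsRationalPt : ProjLine.Point k → Prop
  | none => True
  | some v => ∃ a : k, v = idealXSubC a

/-! ### The uniformizers `X - a` and the order of a product -/

/-- The unit `X - a ∈ k(X)^×`. [cite: MochizukiAbsTopIII2015, Prop 1.6 (ii) p.35] -/
def linUnit (a : k) : (RatFunc k)ˣ :=
  Units.mk0 (algebraMap k[X] (RatFunc k) (X - C a))
    ((map_ne_zero_iff _ (IsFractionRing.injective k[X] (RatFunc k))).mpr (X_sub_C_ne_zero a))

/-- `ord_{(X-b)}(X - a) = [a = b]`: `X - a` is a uniformizer at `(X - a)` and a unit at every other finite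
place. [cite: MochizukiAbsTopIII2015, Prop 1.6 (ii) p.35] -/
theorem ord_linUnit_some (a : k) (w : HeightOneSpectrum k[X]) :
    ProjLine.ord (linUnit k a) (some w) = if w = idealXSubC a then 1 else 0 := by
  rw [ProjLine.ord_some]
  change -WithZero.log (w.valuation (RatFunc k) (algebraMap k[X] (RatFunc k) (X - C a))) = _
  rw [HeightOneSpectrum.valuation_of_algebraMap]
  split_ifs with hw
  · subst hw
    rw [HeightOneSpectrum.intValuation_singleton _ (X_sub_C_ne_zero a) (idealXSubC_asIdeal a),
      WithZero.log_exp, neg_neg]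
  · have hnot : X - C a ∉ w.asIdeal := by
      intro hmem
      apply hw
      have hle : (idealXSubC a).asIdeal ≤ w.asIdeal := by
        rw [idealXSubC_asIdeal, Ideal.span_le, Set.singleton_subset_iff]
        exact hmem
      haveI := (idealXSubC a).isPrime
      have hmax : (idealXSubC a).asIdeal.IsMaximal :=
        IsPrime.to_maximal_ideal (idealXSubC a).ne_bot
      exact HeightOneSpectrum.ext (hmax.eq_of_le w.isPrime.ne_top hle).symm
    rw [HeightOneSpectrum.intValuation_eq_one_iff.mpr hnot, WithZero.log_one, neg_zero]

/-- `ord_∞(X - a) = -1` (a simple pole at infinity). [cite: MochizukiAbsTopIII2015, Prop 1.6 (ii) p.35] -/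
theorem ord_linUnit_none (a : k) : ProjLine.ord (linUnit k a) none = -1 := by
  rw [ProjLine.ord_none]
  change -RatFunc.intDegree (algebraMap k[X] (RatFunc k) (X - C a)) = -1
  rw [RatFunc.intDegree_polynomial, natDegree_X_sub_C, Nat.cast_one]

/-- The local generator attached to a closed point: `X - a` at the rational finite place `(X - a)`, and `1`
at `∞` and at the places of degree `≥ 2` (unused there). [cite: MochizukiAbsTopIII2015, Prop 1.6 (ii) p.35] -/
def gen : ProjLine.Point k → (RatFunc k)ˣ
  | none => 1
  | some v => if h : ∃ a : k, v = idealXSubC a then linUnit k h.choose else 1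

/-- `ord_{(X-b)}` of the generator of a rational finite place `x`: `1` if `x = (X - b)`, else `0`.
[cite: MochizukiAbsTopIII2015, Prop 1.6 (ii) p.35] -/
theorem ord_gen_some {v : HeightOneSpectrum k[X]} (hv : ∃ a : k, v = idealXSubC a)
    (w : HeightOneSpectrum k[X]) :
    ProjLine.ord (gen k (some v)) (some w) = if some v = some w then 1 else 0 := by
  simp only [gen, dif_pos hv]
  rw [ord_linUnit_some, ← hv.choose_spec]
  by_cases hw : w = v
  · subst hw; simp
  · rw [if_neg hw, if_neg (fun h => hw (Option.some_injective _ h).symm)]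

/-- `ord_∞` of the generator of a rational finite place is `-1`. [cite: MochizukiAbsTopIII2015, Prop 1.6 (ii) p.35] -/
theorem ord_gen_some_none {v : HeightOneSpectrum k[X]} (hv : ∃ a : k, v = idealXSubC a) :
    ProjLine.ord (gen k (some v)) none = -1 := by
  simp only [gen, dif_pos hv]
  rw [ord_linUnit_none]

/-- `ord` of a product `∏_x gen(x)^{D(x)}` is the `D`-weighted sum of the `ord`'s.
[cite: MochizukiAbsTopIII2015, Prop 1.6 (ii) p.35] -/
theorem ord_finsuppProd (P : ProjLine.Point k) (D : ProjLine.Point k →₀ ℤ)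
    (g : ProjLine.Point k → (RatFunc k)ˣ) :
    ProjLine.ord (D.prod fun x n => g x ^ n) P = D.sum fun x n => n * ProjLine.ord (g x) P := by
  have h := congrArg Multiplicative.toAdd (map_finsuppProd (ordHom k P) D fun x n => g x ^ n)
  rw [toAdd_ordHom] at h
  rw [h, Finsupp.prod, toAdd_prod, Finsupp.sum]
  refine Finset.sum_congr rfl fun x _ => ?_
  rw [map_zpow, toAdd_zpow, toAdd_ordHom, smul_eq_mul]

variable [CharZero k]

/-! ### `Π_{ℙ¹_k} = G_k` (`Δ = 1`), no cusps, the unique section -/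

/-- `π₁(ℙ¹_k) = G_k`: the extension `1 → 1 → G_k → G_k → 1` (`Δ_{ℙ¹} = π₁(ℙ¹_{k̄}) = 1`).
[cite: MochizukiAbsTopIII2015, Prop 1.4 p.31] -/
def ext : FundamentalExtension.{0} where
  arith := absoluteGaloisGrp k
  gal := absoluteGaloisGrp k
  aug := ContinuousMonoidHom.id _
  aug_surjective := Function.surjective_id

/-- `Δ_{ℙ¹} = 1`. [cite: MochizukiAbsTopIII2015, Prop 1.4 p.31] -/
theorem geom_ext_eq_bot : (ext k).geom = ⊥ := by
  rw [eq_bot_iff]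
  intro x hx
  exact (FundamentalExtension.mem_geom (E := ext k)).mp hx

/-- `ℙ¹` is proper: no cusps. [cite: MochizukiAbsTopIII2015, Prop 1.4 p.31] -/
abbrev cusps : (ext k).CuspidalData where
  Cusp := PEmpty
  Dcusp x := x.elim
  Icusp x := x.elim
  Icusp_eq x := x.elim
  isClosed_Dcusp x := x.elim
  eq_of_conj x := x.elim

/-- The section `s_x = id : G_k → Π_{ℙ¹} = G_k` of a rational point (the unique section).
[cite: MochizukiAbsTopIII2015, Prop 1.6 (ii) p.35] -/
def idSection : (ext k).Section where
  toHom := ContinuousMonoidHom.id _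
  aug_toHom _ := rfl

/-- Its decomposition group is all of `Π_{ℙ¹} = G_k`. [cite: MochizukiAbsTopIII2015, Prop 1.6 (ii) p.35] -/
theorem decompositionGroup_idSection : (idSection k).decompositionGroup = ⊤ :=
  top_unique fun σ _ => ⟨σ, rfl⟩

variable {k} in
/-- When `Π ↠ G` is injective (`Δ = 1`), any two sections agree, so every difference `t_s(σ) t_t(σ)⁻¹` is
trivial — the group-theoretic shadow of `J(ℙ¹) = 0`. [cite: MochizukiAbsTopIII2015, Prop 1.6 (ii) p.35] -/
theorem sectionDiff_eq_one_of_injective {E : FundamentalExtension.{0}} (hE : Function.Injective E.aug)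
    (s t : E.Section) (σ : E.gal) : sectionDiff s t σ = 1 := by
  have h : s.toHom σ = t.toHom σ := hE (by rw [s.aug_toHom, t.aug_toHom])
  apply Subtype.ext
  rw [coe_sectionDiff, OneMemClass.coe_one, mul_inv_eq_one]
  change (QuotientGroup.mk (s.toHom σ) : PiJ1 E) = QuotientGroup.mk (t.toHom σ)
  rw [h]

/-! ### The carrier -/

/-- **THE PROJECTIVE-LINE CARRIER** of `IntrinsicKummerModel` (hence of `DivisorCurveModel`, `CurveModel`):
`X = ℙ¹_k`, `Π_X = G_k`, no cusps, genus `0`, `K_X = k(X)`, closed points = all places, genuine `ord`,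
rational points `∞, (X - a)` with section `id`, decomposition groups `:= Π_X`, `κ := 1` (the typed
`M_X = Hom(H²(Δ_X, Ẑ), Ẑ)` vanishes for `Δ_X = 1`), NF-flags `True`, `NFFunctionField := k(X)` by fiat.
[cite: MochizukiAbsTopIII2015, Prop 1.6 p.34] -/
abbrev model : IntrinsicKummerModel.{0} where
  Curve := PUnit
  base _ := k
  ext _ := ext k
  galIso _ := Iso.refl _
  cusps _ := cusps k
  IsProper _ := True
  IsScheme _ := True
  genus _ := 0
  FunctionField _ := RatFunc k
  Point _ := ProjLine.Point k
  decomp _ _ := ⊤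
  IsNFCurve _ := True
  IsNFPoint _ _ := True
  IsNFRational _ _ := True
  IsNFConstant _ _ := True
  NFFunctionField _ := RatFunc k
  IsStrictlyBelyiType _ := False
  IsCofiniteOpen _ _ := True
  res _ := 𝟙 _
  IsRationalPt _ := IsRationalPt k
  ptSection _ _ := idSection k
  ptSection_range _ _ := decompositionGroup_idSection k
  ord x := ordHom k x
  kummerMap _ _ := 1

/-! ### `Γ(ℙ¹, 𝒪^×) = k^×` -/

/-- A unit of `k(X)` is regular on `ℙ¹_k` (order `0` at every closed point) iff it is a nonzero constant
(abc-iut-L1's `ProjLine.forall_ord_eq_zero_iff`). [cite: MochizukiAbsTopIII2015, Prop 1.6 (iii) p.35] -/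
theorem mem_regularUnits_iff (U : (model k).Curve) (f : (RatFunc k)ˣ) :
    f ∈ (model k).regularUnits U ↔ ∃ c : k, c ≠ 0 ∧ (f : RatFunc k) = RatFunc.C c := by
  rw [DivisorCurveModel.mem_regularUnits, ← ProjLine.forall_ord_eq_zero_iff]
  exact forall_congr' fun P => by
    change Multiplicative.ofAdd (ProjLine.ord f P) = 1 ↔ _
    exact ofAdd_eq_one

/-- **`Γ(ℙ¹_k, 𝒪^×) = k^×`**: the regular units of the carrier are exactly the constant units.
[cite: MochizukiAbsTopIII2015, Prop 1.6 (iii) p.35] -/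
theorem mem_regularUnits_iff_isConstantUnit (U : (model k).Curve) (f : (RatFunc k)ˣ) :
    f ∈ (model k).regularUnits U ↔ (model k).IsConstantUnit (U := U) f := by
  rw [mem_regularUnits_iff]
  change _ ↔ (f : RatFunc k) ∈ Set.range (algebraMap k (RatFunc k))
  rw [RatFunc.algebraMap_eq_C]
  refine ⟨fun ⟨c, _, hc⟩ => ⟨c, hc.symm⟩, fun ⟨c, hc⟩ => ⟨c, ?_, hc.symm⟩⟩
  rintro rfl
  exact f.ne_zero (by rw [← hc, map_zero])

/-! ### F-0375 `IntrinsicKummerModel.Prop_1_6_iii_units` at `ℙ¹_k` -/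

/-- **F-0375, instance form at `ℙ¹_k` — DEGENERATE in the genus binder only**: `genus ℙ¹ = 0`, so the
hypothesis "`2 ≤ genus X`" of the row never fires (print's hyperbolicity proviso).
[cite: MochizukiAbsTopIII2015, Prop 1.6 (iii) p.35] -/
theorem prop_1_6_iii_units : (model k).Prop_1_6_iii_units :=
  fun _ _ _ _ _ _ hg => absurd hg (Nat.not_succ_le_zero 1)

/-- **The displayed equivalence of F-0375 HOLDS at `ℙ¹_k`, genus hypothesis dropped**: for every regular
unit `f` of `ℙ¹_k`, "all cuspidal restrictions of `κ(f)` vanish" (empty: no cusps) iff "`f` is a constant" —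
TRUE, since `Γ(ℙ¹, 𝒪^×) = k^×`. [cite: MochizukiAbsTopIII2015, Prop 1.6 (iii) p.35] -/
theorem prop_1_6_iii_units_display (U X : (model k).Curve) (h : (model k).IsCofiniteOpen U X)
    (hX : (model k).IsProper X) (f : (model k).regularUnits U) :
    (∀ c : ((model k).cusps U).Cusp, (model k).kummerRes h hX (((model k).cusps U).Icusp c) f = 0) ↔
      (model k).IsConstantUnit (f : ((model k).FunctionField U)ˣ) :=
  iff_of_true (fun c => c.elim) ((mem_regularUnits_iff_isConstantUnit k U f.1).mp f.2)

/-- **The binders of F-0375 that DO fire at `ℙ¹_ℚ`** (all but the genus): cofinite open, proper, scheme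
flags, `IsKummerFaithful ℚ` (`isKummerFaithful_rat`), all cusps rational (none), and the unit binder is
inhabited (`1`); `¬ 2 ≤ genus`. [cite: MochizukiAbsTopIII2015, Prop 1.6 (iii) p.35] -/
theorem binders_prop_1_6_iii_units_rat :
    ∀ U X : (model ℚ).Curve, (model ℚ).IsCofiniteOpen U X ∧ (model ℚ).IsProper X ∧ (model ℚ).IsScheme U ∧
      (model ℚ).IsScheme X ∧ IsKummerFaithful ((model ℚ).base U) ∧
      (∀ c : ((model ℚ).cusps U).Cusp, ((model ℚ).cusps U).IsRational c) ∧
      Nonempty ((model ℚ).regularUnits U) ∧ ¬ 2 ≤ (model ℚ).genus X :=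
  fun _ _ => ⟨trivial, trivial, trivial, trivial, isKummerFaithful_rat, fun c => c.elim, ⟨1⟩,
    Nat.not_succ_le_zero 1⟩

/-! ### `Pic⁰(ℙ¹_k)` on rational divisors, and the divisor cocycles -/

/-- **`Pic⁰(ℙ¹_k)` vanishes on rational divisors**: a degree-`0` divisor on `ℙ¹_k` supported on
`k`-rational points is principal — `D = div(∏_{a} (X - a)^{D(a)})` at EVERY closed point (finite places
by the adic valuations, `∞` by the degree). [cite: MochizukiAbsTopIII2015, Prop 1.6 (ii) p.35] -/
theorem isPrincipal_of_sum_eq_zero {X : (model k).Curve} (D : (model k).Point X →₀ ℤ)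
    (hD : ∀ x ∈ D.support, (model k).IsRationalPt X x) (h0 : (∑ x ∈ D.support, D x) = 0) :
    (model k).IsPrincipal D := by
  classical
  refine ⟨D.prod fun x n => gen k x ^ n, fun P => ?_⟩
  change ProjLine.ord (D.prod fun x n => gen k x ^ n) P = D P
  rw [ord_finsuppProd]
  cases P with
  | some w =>
    rw [← Finsupp.sum_ite_self_eq' D (some w), Finsupp.sum, Finsupp.sum]
    refine Finset.sum_congr rfl fun x hx => ?_
    rcases x with _ | v
    · simp [gen]
    · rw [ord_gen_some k (hD _ hx) w]
      split_ifs <;> simp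
  | none =>
    have hsum : (D.sum fun x n => n * ProjLine.ord (gen k x) none) =
        D.sum fun x n => (if x = none then n else 0) - n := by
      rw [Finsupp.sum, Finsupp.sum]
      refine Finset.sum_congr rfl fun x hx => ?_
      rcases x with _ | v
      · simp [gen]
      · rw [ord_gen_some_none k (hD _ hx)]
        simp
    rw [hsum, Finsupp.sum_sub, Finsupp.sum_ite_self_eq', Finsupp.sum, h0, sub_zero]

/-- **Every divisor cocycle of `ℙ¹_k` is trivial** (all sections of `G_k = G_k` coincide), hence principal.
[cite: MochizukiAbsTopIII2015, Prop 1.6 (ii) p.35] -/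
theorem isPrincipalCocycle_divisorCocycleOf {X : (model k).Curve} (D : (model k).Point X →₀ ℤ)
    (hD : ∀ x ∈ D.support, (model k).IsRationalPt X x) (s₀ : ((model k).ext X).Section) :
    IsPrincipalCocycle s₀ ((model k).divisorCocycleOf D hD s₀) := by
  have hinj : Function.Injective ((model k).ext X).aug := fun _ _ h => h
  have h : (model k).divisorCocycleOf D hD s₀ = fun _ => 1 := by
    funext σ
    unfold DivisorCurveModel.divisorCocycleOf divisorCocycle
    exact Finset.prod_eq_one fun i _ => by rw [sectionDiff_eq_one_of_injective hinj, one_zpow]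
  rw [h]
  exact isPrincipalCocycle_one s₀

/-! ### F-0351 `DivisorCurveModel.Prop_1_6_ii` PROVED at `ℙ¹_k` -/

/-- **F-0351 at `ℙ¹_k` — [AbsTopIII] Prop. 1.6 (ii) (`d = 0` criterion) PROVED for the projective line**
(instance form, 0 hypotheses, head = the decl): for every degree-`0` divisor `D` on `ℙ¹_k` supported on
rational points and every base section, `t_D` is the identity section (cocycle principal) AND `D` is
principal — both sides of the printed equivalence hold (`J(ℙ¹) = 0`, `Pic⁰(ℙ¹) = 0`).
[cite: MochizukiAbsTopIII2015, Prop 1.6 (ii) p.35] -/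
theorem prop_1_6_ii : DivisorCurveModel.Prop_1_6_ii (model k).toDivisorCurveModel :=
  fun _ _ _ _ D hD h0 s₀ =>
    iff_of_true (isPrincipalCocycle_divisorCocycleOf k D hD s₀) (isPrincipal_of_sum_eq_zero k D hD h0)

/-- **F-0351 over `ℚ` (closed instance).** [cite: MochizukiAbsTopIII2015, Prop 1.6 (ii) p.35] -/
theorem prop_1_6_ii_rat : DivisorCurveModel.Prop_1_6_ii (model ℚ).toDivisorCurveModel :=
  prop_1_6_ii ℚ

/-- **F-0351 over `ℚ_p` (closed instance).** [cite: MochizukiAbsTopIII2015, Prop 1.6 (ii) p.35] -/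
theorem prop_1_6_ii_padic (p : ℕ) [Fact p.Prime] :
    DivisorCurveModel.Prop_1_6_ii (model ℚ_[p]).toDivisorCurveModel :=
  prop_1_6_ii ℚ_[p]

/-- **Every binder of F-0351 fires at `ℙ¹_ℚ`**: `X` scheme-like and proper, `ℚ` Kummer-faithful
(`isKummerFaithful_rat`), a NON-ZERO degree-`0` divisor supported on rational points (`[0] - [∞]`), and a
base section (`id`). [cite: MochizukiAbsTopIII2015, Prop 1.6 (ii) p.35] -/
theorem binders_prop_1_6_ii_rat :
    ∀ X : (model ℚ).Curve, (model ℚ).IsScheme X ∧ (model ℚ).IsProper X ∧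
      IsKummerFaithful ((model ℚ).base X) ∧ Nonempty (((model ℚ).ext X).Section) ∧
      ∃ D : (model ℚ).Point X →₀ ℤ, D ≠ 0 ∧ (∀ x ∈ D.support, (model ℚ).IsRationalPt X x) ∧
        (∑ x ∈ D.support, D x) = 0 := by
  classical
  intro X
  refine ⟨trivial, trivial, isKummerFaithful_rat, ⟨idSection ℚ⟩,
    Finsupp.single (some (idealXSubC (0 : ℚ))) 1 - Finsupp.single none 1, ?_, ?_, ?_⟩
  · intro h
    have h1 := DFunLike.congr_fun h none
    rw [Finsupp.sub_apply, Finsupp.single_apply, Finsupp.single_apply, if_neg (Option.some_ne_none _),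
      if_pos rfl, Finsupp.zero_apply] at h1
    exact absurd h1 (by norm_num)
  · intro x hx
    rcases Finset.mem_union.mp (Finsupp.support_sub hx) with h | h
    · obtain rfl := Finset.mem_singleton.mp (Finsupp.support_single_subset h)
      exact ⟨0, rfl⟩
    · obtain rfl := Finset.mem_singleton.mp (Finsupp.support_single_subset h)
      trivial
  · change ((Finsupp.single (some (idealXSubC (0 : ℚ))) (1 : ℤ) - Finsupp.single none 1).sum
      fun _ n => n) = 0
    rw [Finsupp.sum_sub_index (fun _ _ _ => rfl), Finsupp.sum_single_index rfl,
      Finsupp.sum_single_index rfl, sub_self]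

end ProjLineCarrier

end Literature.AnabelianGeometry.AbsoluteAnabelian.AbsTopIII

end
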